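import Summits.BirchSwinnertonDyer.BirchSwinnertonDyer.Theorems.SmallImageMuTransferMuTransferX9StepOneDualOdd
import Summits.BirchSwinnertonDyer.BirchSwinnertonDyer.Theorems.SmallImageMuTransferMuTransferX9StepOneImages
import Summits.BirchSwinnertonDyer.BirchSwinnertonDyer.Theorems.KatoDescentPotSupersingularMuCoreIrrImageFacts
import HarnessLib

/-!
# The K6 `μ`-core under IMAGE FACTS instead of `ρ̄` not onto — part B: the homothety without fixed vector,
# (F8) on the kernels, Lemma 3 (i) and STEP 1 `im h = 𝒯_{J+1}(E)`, at every prime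
# (route `KatoDescentPotSupersingular`, U₀ parent item stmt-BirchSwinnertonDyer-19197 / U₀-ns node 19189;
# route-free helper)

Seat `bsd-potss-k9-c4` g14 (prover; cell `bsd-potss`); `--supports stmt-BirchSwinnertonDyer-19197 --as helper`;
closes nothing.  HONEST FRAMING: BSD is not proved by any of this; nothing is booked; THEOREMS ONLY; the mathematics
and the proof texts are the K6 cells' (`bsd-smallim` k6-c2/koly/lur, `b2b-bsdres` x9/x10; MU-TRANSFER-PROOF §§4–5);
this file only re-keys their hypotheses.  Sequel of part A
(`Theorems/KatoDescentPotSupersingularMuCoreIrrImageFacts.lean`: (SC)/(IF), §1 (F2)/(F8), §2 the central scalar,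
§5 the `p = 3` discharge from `E[3]` irreducible alone).

* §3 `exists_homothety_noFixedVector_of_SC`, `exists_mem_ker_apply_ne_zero_of_SC`,
  `exists_mem_inf_ker_apply_ne_zero_of_SC` — twins of the `StepOneSah{X9,Joint,Odd}` lemmas with (SC) in place
  of `¬Surj`;
* §4 `modPTwist_stable_addSubgroup_eq_tPow_of_IF` (Lemma 3 (i) = p432130's `modPTwist_stable_addSubgroup_eq_tPow`
  fed with part A's topological generator fixing `E[p]`), `…eq_top_of_apply_zero_ne_zero_of_IF`,
  `…shiftEnd_pow_ne_zero_of_IF`, `invTwist_…_of_IF`, `valueSubgroup_eq_top_of_IF`,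
  `valueSubgroup_eq_top_of_towerConst_ne_zero_of_IF`, `valueSubgroup_eq_top_of_shiftH1_iterate_ne_zero_of_IF`,
  `valueSubgroup_inf_eq_top_of_towerConst_ne_zero_of_imageFacts`,
  `valueSubgroup_inf_eq_top_of_shiftH1_iterate_ne_zero_of_imageFacts` — twins of `SmallImageGenerator` /
  `StepOneImages` / `StepOneImageH` / `StepOneDual(Odd)` with (IF) [+ (SC)] in place of `¬Surj`.

At `p = 3` every hypothesis is discharged by part A §5 for EVERY `E/ℚ` with `E[3]` irreducible (9-deficient rows
included).  References: [Serre1972] §2.4 Prop. 15, §2.5–2.6; [Sah1968] Prop. 2.7 (b); [Washington1997]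
§13.1–13.2; [MazurRubin2004] §5.3.
-/

-- the summit and its single problem are both named `BirchSwinnertonDyer` (registry layout D-0017)
set_option linter.dupNamespace false
set_option autoImplicit false

noncomputable section

open Field WeierstrassCurve Literature.NumberTheory.EllipticCurves
  Literature.NumberTheory.GaloisRepresentations Function

namespace Summit.BirchSwinnertonDyer.BirchSwinnertonDyer.Rank1Residual

namespace LevelE

/-! ## §3 The homothety without fixed vector; (F8) non-vanishing on the kernels, from (SC) -/

section Sah

variable (W : WeierstrassCurve ℚ) [W.IsElliptic] (p : ℕ) [Fact p.Prime] (κ κ' : ZpExtension ℚ p)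

omit [W.IsElliptic] in
/-- **The scalar of (SC) has no fixed vector on `E[p]`** (twin of `exists_homothety_noFixedVector_of_ne_two`).
[cite: Sah1968, Prop. 2.7 (b)] [cite: Serre1972, §2.6] -/
theorem exists_homothety_noFixedVector_of_SC
    (hSC : ∃ (z : absoluteGaloisGroup ℚ) (a : ZMod p), a ≠ 1 ∧
      ∀ P : WeierstrassCurve.geomTorsion W (p : ℤ), z • P = a.val • P) :
    ∃ (z : absoluteGaloisGroup ℚ) (a : ℤ),
      (∀ m : WeierstrassCurve.geomTorsion W (p : ℤ), W.torsionGaloisModule (p : ℤ) z m = a • m) ∧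
      (∀ m : WeierstrassCurve.geomTorsion W (p : ℤ), W.torsionGaloisModule (p : ℤ) z m = m → m = 0) := by
  have hp : p.Prime := Fact.out
  obtain ⟨z, a, ha1, hz⟩ := hSC
  have hz' : ∀ m : WeierstrassCurve.geomTorsion W (p : ℤ),
      W.torsionGaloisModule (p : ℤ) z m = (a.val : ℤ) • m := fun m => by
    rw [WeierstrassCurve.torsionGaloisModule_apply_apply, hz m, natCast_zsmul]
  refine ⟨z, (a.val : ℤ), hz', fun m hm => ?_⟩
  have hdvd : ¬ (p : ℤ) ∣ (a.val : ℤ) - 1 := by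
    intro h
    apply ha1
    have h0 : (((a.val : ℤ) - 1 : ℤ) : ZMod p) = 0 := (ZMod.intCast_zmod_eq_zero_iff_dvd _ p).mpr h
    rw [Int.cast_sub, Int.cast_natCast, ZMod.natCast_zmod_val, Int.cast_one, sub_eq_zero] at h0
    exact h0
  exact eq_zero_of_smul_eq_of_prime hp (AddSubgroup.torsionBy.nsmul m) hdvd ((hz' m).symm.trans hm)

/-- **(F8): non-zero classes of `E[p]` are non-zero on `N_J = ker(Γ_ℚ → Aut 𝒯_J(E))`** (twin of
`exists_mem_ker_apply_ne_zero_of_ne_two`). [cite: Sah1968, Prop. 2.7 (b)] [cite: Serre1972, §2.6] -/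
theorem exists_mem_ker_apply_ne_zero_of_SC
    (hSC : ∃ (z : absoluteGaloisGroup ℚ) (a : ZMod p), a ≠ 1 ∧
      ∀ P : WeierstrassCurve.geomTorsion W (p : ℤ), z • P = a.val • P) (J : ℕ)
    (ψ : contOneCocycles (W.torsionGaloisModule (p : ℤ)).toTopRep)
    (hψ : oneCocycleClass (W.torsionGaloisModule (p : ℤ)).toTopRep ψ ≠ 0) :
    ∃ τ ∈ (κ.twistModPRepresentation (W.torsionGaloisModule (p : ℤ))
        (fun P : WeierstrassCurve.geomTorsion W (p : ℤ) => AddSubgroup.torsionBy.nsmul P) J).ker,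
      ψ.1 τ ≠ 0 := by
  have hp : p.Prime := Fact.out
  haveI : Finite (WeierstrassCurve.geomTorsion W (p : ℤ)) :=
    WeierstrassCurve.finite_torsionPoints_holds W (AlgebraicClosure ℚ) (by exact_mod_cast hp.ne_zero)
  obtain ⟨z, a, hza, hz0⟩ := exists_homothety_noFixedVector_of_SC W p hSC
  exact galoisCohomology.exists_mem_apply_ne_zero_of_isOpen (W.torsionGaloisModule (p : ℤ)) _
    (κ.isOpen_ker_twistModPRepresentation (W.torsionGaloisModule (p : ℤ)) _ J)
    (κ.mk_mem_center_quotient_ker_of_smul (W.torsionGaloisModule (p : ℤ)) _ J hza) hz0 ψ hψ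

/-- **(F8) for the pair `(h, h^*)`** (twin of `exists_mem_inf_ker_apply_ne_zero_of_ne_two`): non-zero classes of
`E[p]` are non-zero on `N_J(κ) ⊓ N_{J'}(κ')`. [cite: Sah1968, Prop. 2.7 (b)] [cite: Serre1972, §2.6] -/
theorem exists_mem_inf_ker_apply_ne_zero_of_SC
    (hSC : ∃ (z : absoluteGaloisGroup ℚ) (a : ZMod p), a ≠ 1 ∧
      ∀ P : WeierstrassCurve.geomTorsion W (p : ℤ), z • P = a.val • P) (J J' : ℕ)
    (ψ : contOneCocycles (W.torsionGaloisModule (p : ℤ)).toTopRep)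
    (hψ : oneCocycleClass (W.torsionGaloisModule (p : ℤ)).toTopRep ψ ≠ 0) :
    ∃ τ ∈ (κ.twistModPRepresentation (W.torsionGaloisModule (p : ℤ))
          (fun P : WeierstrassCurve.geomTorsion W (p : ℤ) => AddSubgroup.torsionBy.nsmul P) J).ker ⊓
        (κ'.twistModPRepresentation (W.torsionGaloisModule (p : ℤ))
          (fun P : WeierstrassCurve.geomTorsion W (p : ℤ) => AddSubgroup.torsionBy.nsmul P) J').ker,
      ψ.1 τ ≠ 0 := by
  have hp : p.Prime := Fact.out
  haveI : Finite (WeierstrassCurve.geomTorsion W (p : ℤ)) :=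
    WeierstrassCurve.finite_torsionPoints_holds W (AlgebraicClosure ℚ) (by exact_mod_cast hp.ne_zero)
  obtain ⟨z, a, hza, hz0⟩ := exists_homothety_noFixedVector_of_SC W p hSC
  exact galoisCohomology.exists_mem_apply_ne_zero_of_isOpen (W.torsionGaloisModule (p : ℤ)) _
    ((κ.isOpen_ker_twistModPRepresentation (W.torsionGaloisModule (p : ℤ)) _ J).inter
      (κ'.isOpen_ker_twistModPRepresentation (W.torsionGaloisModule (p : ℤ)) _ J'))
    (mk_mem_center_quotient_inf _ _ z
      (κ.mk_mem_center_quotient_ker_of_smul (W.torsionGaloisModule (p : ℤ)) _ J hza)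
      (κ'.mk_mem_center_quotient_ker_of_smul (W.torsionGaloisModule (p : ℤ)) _ J' hza)) hz0 ψ hψ

end Sah

/-! ## §4 Lemma 3 (i) and STEP 1 `im h = 𝒯_{J+1}(E)`, from (IF) (+ (SC) for the Sah inputs) -/

section StepOne

variable (W : WeierstrassCurve ℚ) [W.IsElliptic] (p : ℕ) [Fact p.Prime] (κ κ' : ZpExtension ℚ p)

/-- **Lemma 3 (i)** (twin of `modPTwist_stable_addSubgroup_eq_tPow_of_irr_of_not_surj`): `E[p]` irreducible
and (IF) ⟹ every `Γ_ℚ`-stable additive subgroup of `𝒯_J(E)` is `T^j 𝒯_J(E)` — p432130's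
`modPTwist_stable_addSubgroup_eq_tPow` fed with the topological generator of §1 fixing `E[p]`.
[cite: Serre1972, §2.4 Prop. 15] [cite: Washington1997, §13.2] -/
theorem modPTwist_stable_addSubgroup_eq_tPow_of_IF (J : ℕ) (hirr : W.HasIrreducibleModPGaloisRep p)
    (hIF : ∀ N : Subgroup (absoluteGaloisGroup ℚ), N.Normal →
      (galoisRepTorsion W (p : ℕ)).ker ≤ N → N.index ≠ p)
    (N : AddSubgroup (Fin J → WeierstrassCurve.geomTorsion W (p : ℤ)))
    (hN : ∀ (σ : absoluteGaloisGroup ℚ) (x : Fin J → WeierstrassCurve.geomTorsion W (p : ℤ)),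
      x ∈ N → W.modPTwist p κ J σ x ∈ N) :
    ∃ j : ℕ, j ≤ J ∧ ∀ x : Fin J → WeierstrassCurve.geomTorsion W (p : ℤ),
      x ∈ N ↔ ∀ i : Fin J, i.val < j → x i = 0 := by
  obtain ⟨γ₀, hγ₀, hγ₀E⟩ := exists_isTopGenerator_forall_smul_eq_of_IF W p κ hIF
  exact modPTwist_stable_addSubgroup_eq_tPow W p κ J hirr hγ₀ hγ₀E N hN

/-- **`h mod T ≠ 0 ⟹ im h = 𝒯_J`** (twin of `modPTwist_stable_addSubgroup_eq_top_of_apply_zero_ne_zero`).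
[cite: Serre1972, §2.4 Prop. 15] -/
theorem modPTwist_stable_addSubgroup_eq_top_of_apply_zero_ne_zero_of_IF (J : ℕ)
    (hirr : W.HasIrreducibleModPGaloisRep p)
    (hIF : ∀ N : Subgroup (absoluteGaloisGroup ℚ), N.Normal →
      (galoisRepTorsion W (p : ℕ)).ker ≤ N → N.index ≠ p) (hJ : 1 ≤ J)
    (N : AddSubgroup (Fin J → WeierstrassCurve.geomTorsion W (p : ℤ)))
    (hN : ∀ (σ : absoluteGaloisGroup ℚ) (x : Fin J → WeierstrassCurve.geomTorsion W (p : ℤ)),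
      x ∈ N → W.modPTwist p κ J σ x ∈ N)
    (h0 : ∃ x ∈ N, x ⟨0, hJ⟩ ≠ 0) : N = ⊤ := by
  obtain ⟨j, -, hiff⟩ := modPTwist_stable_addSubgroup_eq_tPow_of_IF W p κ J hirr hIF N hN
  obtain ⟨x, hxN, hx0⟩ := h0
  have hj : j = 0 := by
    by_contra hj
    exact hx0 ((hiff x).mp hxN ⟨0, hJ⟩ (Nat.pos_of_ne_zero hj))
  refine (AddSubgroup.eq_top_iff' N).mpr fun y => (hiff y).mpr fun i hi => ?_
  rw [hj] at hi
  exact absurd hi (Nat.not_lt_zero _)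

/-- **`T^{J−1} h ≠ 0 ⟹ im h = 𝒯_J`** (twin of `modPTwist_stable_addSubgroup_eq_top_of_shiftEnd_pow_ne_zero`).
[cite: Serre1972, §2.4 Prop. 15] -/
theorem modPTwist_stable_addSubgroup_eq_top_of_shiftEnd_pow_ne_zero_of_IF (J : ℕ)
    (hirr : W.HasIrreducibleModPGaloisRep p)
    (hIF : ∀ N : Subgroup (absoluteGaloisGroup ℚ), N.Normal →
      (galoisRepTorsion W (p : ℕ)).ker ≤ N → N.index ≠ p) (hJ : 1 ≤ J)
    (N : AddSubgroup (Fin J → WeierstrassCurve.geomTorsion W (p : ℤ)))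
    (hN : ∀ (σ : absoluteGaloisGroup ℚ) (x : Fin J → WeierstrassCurve.geomTorsion W (p : ℤ)),
      x ∈ N → W.modPTwist p κ J σ x ∈ N)
    (h0 : ∃ x ∈ N, (shiftEnd (WeierstrassCurve.geomTorsion W (p : ℤ)) J ^ (J - 1)) x ≠ 0) : N = ⊤ := by
  obtain ⟨x, hxN, hx⟩ := h0
  exact modPTwist_stable_addSubgroup_eq_top_of_apply_zero_ne_zero_of_IF W p κ J hirr hIF hJ N hN
    ⟨x, hxN, (shiftEnd_pow_pred_ne_zero_iff J hJ x).mp hx⟩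

/-- Dual side (twin of `invTwist_modPTwist_stable_addSubgroup_eq_top_of_shiftEnd_pow_ne_zero`).
[cite: Serre1972, §2.4 Prop. 15] [cite: Washington1997, §13.1–§13.2] -/
theorem invTwist_modPTwist_stable_addSubgroup_eq_top_of_shiftEnd_pow_ne_zero_of_IF (J : ℕ)
    (hirr : W.HasIrreducibleModPGaloisRep p)
    (hIF : ∀ N : Subgroup (absoluteGaloisGroup ℚ), N.Normal →
      (galoisRepTorsion W (p : ℕ)).ker ≤ N → N.index ≠ p) (hJ : 1 ≤ J)
    (N : AddSubgroup (Fin J → WeierstrassCurve.geomTorsion W (p : ℤ)))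
    (hN : ∀ (σ : absoluteGaloisGroup ℚ) (x : Fin J → WeierstrassCurve.geomTorsion W (p : ℤ)),
      x ∈ N → W.modPTwist p κ.invTwist J σ x ∈ N)
    (h0 : ∃ x ∈ N, (shiftEnd (WeierstrassCurve.geomTorsion W (p : ℤ)) J ^ (J - 1)) x ≠ 0) : N = ⊤ :=
  modPTwist_stable_addSubgroup_eq_top_of_shiftEnd_pow_ne_zero_of_IF W p κ.invTwist J hirr hIF hJ N hN h0

/-- **STEP 1, `im h = 𝒯_{J+1}(E)`** (twin of `valueSubgroup_eq_top`): the value group on a normal `S` acting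
trivially of a cocycle with a value of non-zero constant coefficient is everything.
[cite: Serre1972, §2.4 Prop. 15] [cite: MazurRubin2004, §5.3] -/
theorem valueSubgroup_eq_top_of_IF (hirr : W.HasIrreducibleModPGaloisRep p)
    (hIF : ∀ N : Subgroup (absoluteGaloisGroup ℚ), N.Normal →
      (galoisRepTorsion W (p : ℕ)).ker ≤ N → N.index ≠ p)
    (J : ℕ) (φ : contOneCocycles (W.modPTwist p κ (J + 1)).toTopRep)
    (S : Subgroup (absoluteGaloisGroup ℚ)) [S.Normal]
    (hS : ∀ τ ∈ S, ∀ x : (W.modPTwist p κ (J + 1)).toTopRep,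
      (W.modPTwist p κ (J + 1)).toTopRep.ρ τ x = x)
    (h0 : ∃ τ ∈ S, φ.1 τ ⟨0, Nat.succ_pos J⟩ ≠ 0) :
    contOneCocycles.valueSubgroup φ S hS = ⊤ := by
  obtain ⟨j, -, hiff⟩ := modPTwist_stable_addSubgroup_eq_tPow_of_IF W p κ (J + 1) hirr hIF
    (contOneCocycles.valueSubgroup φ S hS)
    (fun σ x hx => contOneCocycles.smul_mem_valueSubgroup φ _ hS σ hx)
  obtain ⟨τ, hτ, hne⟩ := h0
  have hj : j = 0 := by
    by_contra hj
    exact hne ((hiff (φ.1 τ)).mp ⟨τ, hτ, rfl⟩ ⟨0, Nat.succ_pos J⟩ (Nat.pos_of_ne_zero hj))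
  refine (AddSubgroup.eq_top_iff' _).mpr fun x => (hiff x).mpr fun i hi => ?_
  rw [hj] at hi
  exact absurd hi (Nat.not_lt_zero _)

/-- STEP 1 with the (F8) input on the `Ω`-adic tower (twin of `valueSubgroup_eq_top_of_towerConst_ne_zero`).
[cite: Serre1972, §2.4 Prop. 15] [cite: MazurRubin2004, §5.3] -/
theorem valueSubgroup_eq_top_of_towerConst_ne_zero_of_IF (hirr : W.HasIrreducibleModPGaloisRep p)
    (hIF : ∀ N : Subgroup (absoluteGaloisGroup ℚ), N.Normal →
      (galoisRepTorsion W (p : ℕ)).ker ≤ N → N.index ≠ p)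
    (y : κ.twistTower (W.torsionGaloisModule (p : ℤ))
      (fun P : WeierstrassCurve.geomTorsion W (p : ℤ) => AddSubgroup.torsionBy.nsmul P))
    (hy : κ.towerConst (W.torsionGaloisModule (p : ℤ)) (fun P => AddSubgroup.torsionBy.nsmul P) y ≠ 0)
    (J : ℕ) (φ : contOneCocycles (W.modPTwist p κ (J + 1)).toTopRep)
    (hφ : oneCocycleClass (W.modPTwist p κ (J + 1)).toTopRep φ = y.1 (J + 1))
    (S : Subgroup (absoluteGaloisGroup ℚ)) [S.Normal]
    (hS : ∀ τ ∈ S, ∀ x : (W.modPTwist p κ (J + 1)).toTopRep,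
      (W.modPTwist p κ (J + 1)).toTopRep.ρ τ x = x)
    (hSah : ∀ ψ : contOneCocycles (W.torsionGaloisModule (p : ℤ)).toTopRep,
      oneCocycleClass (W.torsionGaloisModule (p : ℤ)).toTopRep ψ ≠ 0 → ∃ τ ∈ S, ψ.1 τ ≠ 0) :
    contOneCocycles.valueSubgroup φ S hS = ⊤ := by
  refine valueSubgroup_eq_top_of_IF W p κ hirr hIF J φ S hS ?_
  have hc : galoisCohomology.map (κ.twistModPConstCoeff (W.torsionGaloisModule (p : ℤ))
      (fun P => AddSubgroup.torsionBy.nsmul P) (J + 1) (Nat.succ_pos J)) 1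
      (oneCocycleClass (W.modPTwist p κ (J + 1)).toTopRep φ) ≠ 0 := by
    rw [hφ, map_constCoeff_level_eq_towerConst]
    exact hy
  change galoisCohomology.map _ 1 (oneCocycleClass (κ.twistModP (W.torsionGaloisModule (p : ℤ))
      (fun P => AddSubgroup.torsionBy.nsmul P) (J + 1)).toTopRep φ) ≠ 0 at hc
  rw [ZpExtension.map_oneCocycleClass_twist] at hc
  obtain ⟨τ, hτ, hne⟩ := hSah _ hc
  exact ⟨τ, hτ, hne⟩

/-- Dual side of STEP 1 (twin of `valueSubgroup_eq_top_of_shiftH1_iterate_ne_zero`): `T^J [ψ] ≠ 0 ⟹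
ψ(S) = 𝒯_{J+1}(E, κ)`. [cite: Serre1972, §2.4 Prop. 15] [cite: MazurRubin2004, §5.3] -/
theorem valueSubgroup_eq_top_of_shiftH1_iterate_ne_zero_of_IF (hirr : W.HasIrreducibleModPGaloisRep p)
    (hIF : ∀ N : Subgroup (absoluteGaloisGroup ℚ), N.Normal →
      (galoisRepTorsion W (p : ℕ)).ker ≤ N → N.index ≠ p) (J : ℕ)
    (ψ : contOneCocycles (W.modPTwist p κ (J + 1)).toTopRep)
    (hψ : (κ.shiftH1 (W.torsionGaloisModule (p : ℤ))
      (fun P : WeierstrassCurve.geomTorsion W (p : ℤ) => AddSubgroup.torsionBy.nsmul P) (J + 1))^[J]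
        (oneCocycleClass (W.modPTwist p κ (J + 1)).toTopRep ψ) ≠ 0)
    (S : Subgroup (absoluteGaloisGroup ℚ)) [S.Normal]
    (hS : ∀ τ ∈ S, ∀ x : (W.modPTwist p κ (J + 1)).toTopRep,
      (W.modPTwist p κ (J + 1)).toTopRep.ρ τ x = x)
    (hSah : ∀ ψ' : contOneCocycles (W.torsionGaloisModule (p : ℤ)).toTopRep,
      oneCocycleClass (W.torsionGaloisModule (p : ℤ)).toTopRep ψ' ≠ 0 → ∃ τ ∈ S, ψ'.1 τ ≠ 0) :
    contOneCocycles.valueSubgroup ψ S hS = ⊤ := by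
  have hc := κ.map_constCoeff_ne_zero_of_shiftH1_iterate_ne_zero (W.torsionGaloisModule (p : ℤ))
    (fun P => AddSubgroup.torsionBy.nsmul P) (Nat.succ_pos J) _ hψ
  change galoisCohomology.map _ 1 (oneCocycleClass (κ.twistModP (W.torsionGaloisModule (p : ℤ))
      (fun P => AddSubgroup.torsionBy.nsmul P) (J + 1)).toTopRep ψ) ≠ 0 at hc
  rw [ZpExtension.map_oneCocycleClass_twist] at hc
  obtain ⟨τ, hτ, hne⟩ := hSah _ hc
  exact valueSubgroup_eq_top_of_IF W p κ hirr hIF J ψ S hS ⟨τ, hτ, hne⟩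

/-- **STEP 1, `h`-side on the joint kernel** (twin of `valueSubgroup_inf_eq_top_of_towerConst_ne_zero_of_ne_two`).
[cite: Serre1972, §2.4 Prop. 15 and §2.6] [cite: MazurRubin2004, §5.3] [cite: Sah1968, Prop. 2.7 (b)] -/
theorem valueSubgroup_inf_eq_top_of_towerConst_ne_zero_of_imageFacts
    (hirr : W.HasIrreducibleModPGaloisRep p)
    (hSC : ∃ (z : absoluteGaloisGroup ℚ) (a : ZMod p), a ≠ 1 ∧
      ∀ P : WeierstrassCurve.geomTorsion W (p : ℤ), z • P = a.val • P)
    (hIF : ∀ N : Subgroup (absoluteGaloisGroup ℚ), N.Normal →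
      (galoisRepTorsion W (p : ℕ)).ker ≤ N → N.index ≠ p)
    (y : κ.twistTower (W.torsionGaloisModule (p : ℤ))
      (fun P : WeierstrassCurve.geomTorsion W (p : ℤ) => AddSubgroup.torsionBy.nsmul P))
    (hy : κ.towerConst (W.torsionGaloisModule (p : ℤ)) (fun P => AddSubgroup.torsionBy.nsmul P) y ≠ 0)
    (J J' : ℕ) (φ : contOneCocycles (W.modPTwist p κ (J + 1)).toTopRep)
    (hφ : oneCocycleClass (W.modPTwist p κ (J + 1)).toTopRep φ = y.1 (J + 1)) :
    contOneCocycles.valueSubgroup φ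
      ((κ.twistModPRepresentation (W.torsionGaloisModule (p : ℤ))
          (fun P : WeierstrassCurve.geomTorsion W (p : ℤ) => AddSubgroup.torsionBy.nsmul P) (J + 1)).ker ⊓
        (κ'.twistModPRepresentation (W.torsionGaloisModule (p : ℤ))
          (fun P : WeierstrassCurve.geomTorsion W (p : ℤ) => AddSubgroup.torsionBy.nsmul P) J').ker)
      (fun _ hτ x => κ.toTopRep_ρ_apply_eq_self_of_mem_ker (W.torsionGaloisModule (p : ℤ)) _ (J + 1)
        (Subgroup.mem_inf.mp hτ).1 x) = ⊤ :=
  valueSubgroup_eq_top_of_towerConst_ne_zero_of_IF W p κ hirr hIF y hy J φ hφ _ _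
    (fun ψ hψ => exists_mem_inf_ker_apply_ne_zero_of_SC W p κ κ' hSC (J + 1) J' ψ hψ)

/-- **STEP 1, `h^*`-side on the joint kernel** (twin of
`valueSubgroup_inf_eq_top_of_shiftH1_iterate_ne_zero_of_ne_two`). [cite: Serre1972, §2.4 Prop. 15 and §2.6]
[cite: MazurRubin2004, §5.3] [cite: Sah1968, Prop. 2.7 (b)] -/
theorem valueSubgroup_inf_eq_top_of_shiftH1_iterate_ne_zero_of_imageFacts
    (hirr : W.HasIrreducibleModPGaloisRep p)
    (hSC : ∃ (z : absoluteGaloisGroup ℚ) (a : ZMod p), a ≠ 1 ∧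
      ∀ P : WeierstrassCurve.geomTorsion W (p : ℤ), z • P = a.val • P)
    (hIF : ∀ N : Subgroup (absoluteGaloisGroup ℚ), N.Normal →
      (galoisRepTorsion W (p : ℕ)).ker ≤ N → N.index ≠ p) (J J' : ℕ)
    (ψ : contOneCocycles (W.modPTwist p κ' (J' + 1)).toTopRep)
    (hψ : (κ'.shiftH1 (W.torsionGaloisModule (p : ℤ))
      (fun P : WeierstrassCurve.geomTorsion W (p : ℤ) => AddSubgroup.torsionBy.nsmul P) (J' + 1))^[J']
        (oneCocycleClass (W.modPTwist p κ' (J' + 1)).toTopRep ψ) ≠ 0) :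
    contOneCocycles.valueSubgroup ψ
      ((κ.twistModPRepresentation (W.torsionGaloisModule (p : ℤ))
          (fun P : WeierstrassCurve.geomTorsion W (p : ℤ) => AddSubgroup.torsionBy.nsmul P) J).ker ⊓
        (κ'.twistModPRepresentation (W.torsionGaloisModule (p : ℤ))
          (fun P : WeierstrassCurve.geomTorsion W (p : ℤ) => AddSubgroup.torsionBy.nsmul P) (J' + 1)).ker)
      (fun _ hτ x => κ'.toTopRep_ρ_apply_eq_self_of_mem_ker (W.torsionGaloisModule (p : ℤ)) _ (J' + 1)
        (Subgroup.mem_inf.mp hτ).2 x) = ⊤ :=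
  valueSubgroup_eq_top_of_shiftH1_iterate_ne_zero_of_IF W p κ' hirr hIF J' ψ hψ _ _
    (fun ψ' hψ' => exists_mem_inf_ker_apply_ne_zero_of_SC W p κ κ' hSC J (J' + 1) ψ' hψ')

end StepOne

end LevelE

end Summit.BirchSwinnertonDyer.BirchSwinnertonDyer.Rank1Residual
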